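import Literature.LinearAlgebra.Matrix.UnitaryBlockPauliFrameTrace   -- ★ p843350 (this lineage): `SU2Block.inv_eq_diagonal_inv_mul_conjTranspose_mul_diagonal` (`M′ = H⁻¹MᴴH`)
import Mathlib.LinearAlgebra.Complex.Module                           -- `Complex.coe_smul`
import HarnessLib

/-!
# Real bilinear maps on `M_N(ℂ)`: complex scalars, and the `Ad`-invariance of the SWAP tensor `Σ E_kl ⊗ E_lk` and of its `H`-hermitian twin `Σ (e_l∕e_k) E_kl ⊗ Ē_kl`
# (the two halves of the Fierz ∕ completeness identity `Σ σ_a ⊗ σ_a = 2·SWAP − 1⊗1` seen by an `ℝ`-bilinear form; Hall GTM 222 §3.5–§3.6, Horn–Johnson §2.2)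

Topic `LinearAlgebra/Matrix`; namespace `Literature.LinearAlgebra.Matrix`.  THEOREMS ONLY (no `def`, no instance, no notation, no axiom, no named fact, no `sorry`).
Written for cell `pub/hodgecm-mathlib` (ENGINE T1, crux H413 = `stmt-HodgeConjecture-24833`), ROAD A brick **(A4-0) «CASIMIR TENSOR OF `𝔰𝔲(x^⊥)` IN THE CHART»**
(F0P3a-p05 (g13) census 19b229d9 §2; A-p14 (g29) census 8d63e285 «frame-free form»; LEAD F0P3a-plan (g10) T9-14 (4)), part 1 of 2: the two invariances that turn the
Pauli-frame sum of a REAL bilinear map into a polynomial in the block projector (part 2 = `UnitaryBlockPauliFrameCasimir`).  Nothing here is specific to unitary groups over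
number fields; author A-p14 (g29), 2026-09-01.

THE MATHEMATICS.  Let `q : M_N(ℂ) × M_N(ℂ) → E` be `ℝ`-bilinear (NOT `ℂ`-bilinear: the consumer is `D²Θ(h)[·,·]` for a function `Θ` that is only real-differentiable).
* §1 A complex scalar acts through `z•A = (re z)•A + (im z)•(I•A)`, so `q(z•A, B) = re z • q(A,B) + im z • q(I•A, B)`.  The combination `Qb(A,B) = q(A,B) − q(I•A, I•B)` is
  `I`-BALANCED (`Qb(I•A,B) = Qb(A,I•B)`: it factors through `⊗_ℂ`) and sees two scalars only through their product, `Qb(z•A, w•B) = re(zw)•Qb(A,B) + im(zw)•Qb(I•A,B)`;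
  the combination `R(A,B) = q(A,B) + q(I•A, I•B)` is `I`-SKEW-BALANCED (`R(I•A,B) = −R(A,I•B)`: it factors through `M ⊗_ℂ M̄`) and sees `z w̄`.  Hence the two
  CONTRACTION RULES `sum_apply_sum_smul_of_balanced ∕ _of_skew`: `Σ_l Qb(Σ_b B_lb•X_b, Σ_c C_lc•Y_c) = Σ_b Qb(X_b, Y_b)` when `Σ_l B_lb C_lc = δ_bc`, and the analogue for `R`
  with `Σ_l B_lb conj(C_lc) = u_b δ_bc`.
* §2 For `M M′ = 1` and the matrix units `E_kl = Matrix.single k l 1` (`M E_kl M′ = Σ_b M′_lb • (M E_kb) = Σ_c M_cl • (E_ck M′)`), two applications of the contraction rules give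
  **`sum_sum_conj_single_swap_eq`**: `Σ_{k,l} Qb(M E_kl M′, M E_lk M′) = Σ_{k,l} Qb(E_kl, E_lk)` (the SWAP tensor `Σ E_kl ⊗_ℂ E_lk` is `Ad ⊗ Ad`-invariant — FALSE without the
  `I•` correction, e.g. `N = 2`, `M = diag(i,1)`), and, for `H = diag e` real nowhere zero and `M` `H`-unitary (`MᴴHM = H`, so `M′ = H⁻¹MᴴH` and `M H⁻¹ Mᴴ = H⁻¹`, i.e.
  `Σ_k e_k⁻¹ M_ak conj(M_ck) = δ_ac e_a⁻¹`), **`sum_sum_smul_conj_single_same_eq`**: `Σ_{k,l} re(e_l∕e_k) • R(M E_kl M′, M E_kl M′) = Σ_{k,l} re(e_l∕e_k) • R(E_kl, E_kl)`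
  (the hermitian twin `Σ (e_l∕e_k) E_kl ⊗ Ē_kl ∈ M ⊗_ℂ M̄` is `U(H)`-invariant).
HONEST LABEL: elementary linear algebra; for the cell it pays nothing by itself (HC_CM is proved only modulo the printed citations until rung 0 closes).

## References
* [Hall2015] B. C. Hall, *Lie Groups, Lie Algebras, and Representations*, 2nd ed., GTM 222 (2015), §3.5 (the adjoint action), §3.6 (complexification of a real Lie algebra; real forms).
* [HornJohnson2013] R. A. Horn, C. R. Johnson, *Matrix Analysis*, 2nd ed. (2013), §0.2 (matrix units, products), §2.2 (unitary similarity; `H`-unitary matrices and their inverses).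
-/

set_option autoImplicit false

noncomputable section

open Finset Matrix Complex
open scoped ComplexConjugate

namespace Literature.LinearAlgebra.Matrix

variable {N : ℕ} {E : Type*} [AddCommGroup E] [Module ℝ E]

/-! ## §1 Real bilinear maps and complex scalars -/

/-- A complex scalar acts through its real and imaginary parts: `z • A = (re z) • A + (im z) • (I • A)` (real scalars on the right). [cite: Hall2015, §3.6] -/
theorem complex_smul_eq_re_smul_add_im_smul_I_smul {V : Type*} [AddCommGroup V] [Module ℂ V] (z : ℂ) (A : V) :
    z • A = z.re • A + z.im • (I • A) := by
  conv_lhs => rw [← Complex.re_add_im z]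
  rw [add_smul, mul_smul, Complex.coe_smul, Complex.coe_smul]

/-- **SCALAR RULE, LEFT SLOT**: for a real bilinear `q` on a complex vector space, `q (z • A) B = (re z) • q A B + (im z) • q (I • A) B`. [cite: HornJohnson2013, §2.2] -/
theorem apply_smul_left {V : Type*} [AddCommGroup V] [Module ℂ V] (q : V →ₗ[ℝ] V →ₗ[ℝ] E) (z : ℂ) (A B : V) :
    q (z • A) B = z.re • q A B + z.im • q (I • A) B := by
  rw [complex_smul_eq_re_smul_add_im_smul_I_smul z A, map_add, map_smul, map_smul, LinearMap.add_apply, LinearMap.smul_apply, LinearMap.smul_apply]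

/-- **SCALAR RULE, RIGHT SLOT**: `q A (z • B) = (re z) • q A B + (im z) • q A (I • B)`. [cite: HornJohnson2013, §2.2] -/
theorem apply_smul_right {V : Type*} [AddCommGroup V] [Module ℂ V] (q : V →ₗ[ℝ] V →ₗ[ℝ] E) (z : ℂ) (A B : V) :
    q A (z • B) = z.re • q A B + z.im • q A (I • B) := by
  rw [complex_smul_eq_re_smul_add_im_smul_I_smul z B, map_add, map_smul, map_smul]

/-- **BALANCED PRODUCT RULE**: if `Qb` is real bilinear and `I`-balanced (`Qb (I•A) B = Qb A (I•B)`), then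
`Qb (z • A) (w • B) = re(zw) • Qb A B + im(zw) • Qb (I • A) B` — `Qb` sees the product `zw` only (it factors through `⊗_ℂ`). [cite: Hall2015, §3.6] -/
theorem apply_smul_smul_of_balanced {V : Type*} [AddCommGroup V] [Module ℂ V] (Qb : V →ₗ[ℝ] V →ₗ[ℝ] E)
    (hQb : ∀ A B, Qb (I • A) B = Qb A (I • B)) (z w : ℂ) (A B : V) :
    Qb (z • A) (w • B) = (z * w).re • Qb A B + (z * w).im • Qb (I • A) B := by
  have h2 : Qb (I • A) (I • B) = -Qb A B := by
    rw [← hQb, smul_smul, Complex.I_mul_I, neg_smul, one_smul, map_neg, LinearMap.neg_apply]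
  rw [apply_smul_left Qb z A (w • B), apply_smul_right Qb w A B, apply_smul_right Qb w (I • A) B, ← hQb A B, h2, Complex.mul_re, Complex.mul_im]
  module

/-- **CONJUGATE-BALANCED PRODUCT RULE**: if `R` is real bilinear and `I`-skew-balanced (`R (I•A) B = −R A (I•B)`), then
`R (z • A) (w • B) = re(z·w̄) • R A B + im(z·w̄) • R (I • A) B` — `R` sees `z w̄` only (it factors through `V ⊗_ℂ V̄`). [cite: Hall2015, §3.6] -/
theorem apply_smul_smul_of_skew {V : Type*} [AddCommGroup V] [Module ℂ V] (R : V →ₗ[ℝ] V →ₗ[ℝ] E)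
    (hR : ∀ A B, R (I • A) B = -R A (I • B)) (z w : ℂ) (A B : V) :
    R (z • A) (w • B) = (z * conj w).re • R A B + (z * conj w).im • R (I • A) B := by
  have h1 : R A (I • B) = -R (I • A) B := by rw [hR, neg_neg]
  have h2 : R (I • A) (I • B) = R A B := by
    rw [hR, smul_smul, Complex.I_mul_I, neg_smul, one_smul, map_neg, neg_neg]
  rw [apply_smul_left R z A (w • B), apply_smul_right R w A B, apply_smul_right R w (I • A) B, h1, h2, Complex.mul_re, Complex.mul_im,
    Complex.conj_re, Complex.conj_im]
  module


/-- **CONTRACTION RULE (balanced)**: if `Σ_l B_lb C_lc = δ_bc`, then `Σ_l Qb (Σ_b B_lb • X_b) (Σ_c C_lc • Y_c) = Σ_b Qb X_b Y_b` for an `I`-balanced real bilinear `Qb`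
(the complex coefficients pair through `Qb` as `B_lb C_lc`). [cite: HornJohnson2013, §2.2] -/
theorem sum_apply_sum_smul_of_balanced {V : Type*} [AddCommGroup V] [Module ℂ V] (Qb : V →ₗ[ℝ] V →ₗ[ℝ] E)
    (hQb : ∀ A B, Qb (I • A) B = Qb A (I • B)) (X Y : Fin N → V) (B C : Fin N → Fin N → ℂ)
    (hBC : ∀ b c, ∑ l, B l b * C l c = if b = c then 1 else 0) :
    ∑ l, Qb (∑ b, B l b • X b) (∑ c, C l c • Y c) = ∑ b, Qb (X b) (Y b) := by
  have hexp : ∀ l, Qb (∑ b, B l b • X b) (∑ c, C l c • Y c) =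
      ∑ b, ∑ c, ((B l b * C l c).re • Qb (X b) (Y c) + (B l b * C l c).im • Qb (I • X b) (Y c)) := fun l => by
    rw [map_sum Qb, LinearMap.sum_apply]
    refine Finset.sum_congr rfl fun b _ => ?_
    rw [map_sum (Qb (B l b • X b))]
    exact Finset.sum_congr rfl fun c _ => apply_smul_smul_of_balanced Qb hQb _ _ _ _
  simp_rw [hexp]
  rw [Finset.sum_comm]
  refine Finset.sum_congr rfl fun b _ => ?_
  rw [Finset.sum_comm]
  have hre : ∀ c, ∑ l, (B l b * C l c).re = if b = c then 1 else 0 := fun c => by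
    rw [← Complex.re_sum, hBC]; split_ifs <;> simp
  have him : ∀ c, ∑ l, (B l b * C l c).im = 0 := fun c => by
    rw [← Complex.im_sum, hBC]; split_ifs <;> simp
  simp_rw [Finset.sum_add_distrib, ← Finset.sum_smul, hre, him]
  simp only [zero_smul, ite_smul, one_smul, Finset.sum_ite_eq, Finset.mem_univ, if_true, Finset.sum_const_zero, add_zero]

/-- **CONTRACTION RULE (skew)**: if `Σ_l B_lb · conj(C_lc) = u_b δ_bc` with `u` real, then `Σ_l R (Σ_b B_lb • X_b) (Σ_c C_lc • Y_c) = Σ_b u_b • R X_b Y_b` for an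
`I`-skew-balanced real bilinear `R` (the coefficients pair as `B_lb conj(C_lc)`). [cite: HornJohnson2013, §2.2] -/
theorem sum_apply_sum_smul_of_skew {V : Type*} [AddCommGroup V] [Module ℂ V] (R : V →ₗ[ℝ] V →ₗ[ℝ] E)
    (hR : ∀ A B, R (I • A) B = -R A (I • B)) (X Y : Fin N → V) (B C : Fin N → Fin N → ℂ) (u : Fin N → ℝ)
    (hBC : ∀ b c, ∑ l, B l b * conj (C l c) = if b = c then ((u b : ℝ) : ℂ) else 0) :
    ∑ l, R (∑ b, B l b • X b) (∑ c, C l c • Y c) = ∑ b, u b • R (X b) (Y b) := by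
  have hexp : ∀ l, R (∑ b, B l b • X b) (∑ c, C l c • Y c) =
      ∑ b, ∑ c, ((B l b * conj (C l c)).re • R (X b) (Y c) + (B l b * conj (C l c)).im • R (I • X b) (Y c)) := fun l => by
    rw [map_sum R, LinearMap.sum_apply]
    refine Finset.sum_congr rfl fun b _ => ?_
    rw [map_sum (R (B l b • X b))]
    exact Finset.sum_congr rfl fun c _ => apply_smul_smul_of_skew R hR _ _ _ _
  simp_rw [hexp]
  rw [Finset.sum_comm]
  refine Finset.sum_congr rfl fun b _ => ?_
  rw [Finset.sum_comm]
  have hre : ∀ c, ∑ l, (B l b * conj (C l c)).re = if b = c then u b else 0 := fun c => by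
    rw [← Complex.re_sum, hBC]; split_ifs <;> simp
  have him : ∀ c, ∑ l, (B l b * conj (C l c)).im = 0 := fun c => by
    rw [← Complex.im_sum, hBC]; split_ifs <;> simp
  simp_rw [Finset.sum_add_distrib, ← Finset.sum_smul, hre, him]
  simp only [zero_smul, ite_smul, Finset.sum_ite_eq, Finset.mem_univ, if_true, Finset.sum_const_zero, add_zero]

/-! ## §2 Conjugated matrix units: the SWAP tensor is `Ad`-invariant, and so is its `H`-hermitian twin -/

/-- `E_kl · B = Σ_b B_lb • E_kb`. [cite: HornJohnson2013, §0.2] -/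
theorem single_mul_eq_sum_smul (k l : Fin N) (B : Matrix (Fin N) (Fin N) ℂ) :
    Matrix.single k l (1 : ℂ) * B = ∑ b, B l b • Matrix.single k b (1 : ℂ) := by
  ext a c
  rw [Matrix.sum_apply]
  by_cases hak : a = k
  · subst hak
    simp only [Matrix.single_mul_apply_same, one_mul, Matrix.smul_apply, Matrix.single_apply, true_and, smul_eq_mul, mul_ite, mul_one, mul_zero,
      Finset.sum_ite_eq', Finset.mem_univ, if_true]
  · rw [Matrix.single_mul_apply_of_ne (h := hak), Finset.sum_eq_zero]
    intro b _
    rw [Matrix.smul_apply, Matrix.single_apply_of_row_ne (Ne.symm hak), smul_zero]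

/-- `C · E_lk = Σ_c C_cl • E_ck`. [cite: HornJohnson2013, §0.2] -/
theorem mul_single_eq_sum_smul (l k : Fin N) (C : Matrix (Fin N) (Fin N) ℂ) :
    C * Matrix.single l k (1 : ℂ) = ∑ c, C c l • Matrix.single c k (1 : ℂ) := by
  ext a d
  rw [Matrix.sum_apply]
  by_cases hdk : d = k
  · subst hdk
    simp only [Matrix.mul_single_apply_same, mul_one, Matrix.smul_apply, Matrix.single_apply, and_true, smul_eq_mul, mul_ite, mul_zero,
      Finset.sum_ite_eq', Finset.mem_univ, if_true]
  · rw [Matrix.mul_single_apply_of_ne (hbj := hdk), Finset.sum_eq_zero]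
    intro c _
    rw [Matrix.smul_apply, Matrix.single_apply_of_col_ne _ _ (Ne.symm hdk), smul_zero]


/-- `M · E_kl · M′ = Σ_b M′_lb • (M · E_kb)` (expand the right factor). [cite: HornJohnson2013, §0.2] -/
theorem conj_single_eq_sum_smul_right (M M' : Matrix (Fin N) (Fin N) ℂ) (k l : Fin N) :
    M * Matrix.single k l (1 : ℂ) * M' = ∑ b, M' l b • (M * Matrix.single k b (1 : ℂ)) := by
  rw [Matrix.mul_assoc, single_mul_eq_sum_smul, Finset.mul_sum]
  simp_rw [Matrix.mul_smul]

/-- `M · E_lk · M′ = Σ_c M_cl • (E_ck · M′)` (expand the left factor). [cite: HornJohnson2013, §0.2] -/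
theorem conj_single_eq_sum_smul_left (M M' : Matrix (Fin N) (Fin N) ℂ) (l k : Fin N) :
    M * Matrix.single l k (1 : ℂ) * M' = ∑ c, M c l • (Matrix.single c k (1 : ℂ) * M') := by
  rw [mul_single_eq_sum_smul, Finset.sum_mul]
  simp_rw [Matrix.smul_mul]

/-- **THE SWAP TENSOR IS `Ad`-INVARIANT (real-bilinear form)**: for every real bilinear `q` on `M_N(ℂ)` and `M M′ = 1`,
`Σ_{k,l} [q(M E_kl M′, M E_lk M′) − q(I•M E_kl M′, I•M E_lk M′)] = Σ_{k,l} [q(E_kl, E_lk) − q(I•E_kl, I•E_lk)]`.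
The bracket is the `I`-balanced part of `q`, which factors through `M_N(ℂ) ⊗_ℂ M_N(ℂ)`, where `Σ_{k,l} E_kl ⊗ E_lk = SWAP` is invariant under `Ad(M) ⊗ Ad(M)`;
without the `I•` correction the statement is FALSE for real-bilinear `q` (take `N = 2`, `M = diag(i, 1)`). [cite: Hall2015, Prop. 3.24] [cite: HornJohnson2013, §2.2] -/
theorem sum_sum_conj_single_swap_eq (q : Matrix (Fin N) (Fin N) ℂ →ₗ[ℝ] Matrix (Fin N) (Fin N) ℂ →ₗ[ℝ] E)
    {M M' : Matrix (Fin N) (Fin N) ℂ} (hMM' : M * M' = 1) :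
    ∑ k, ∑ l, (q (M * Matrix.single k l 1 * M') (M * Matrix.single l k 1 * M') -
        q (I • (M * Matrix.single k l 1 * M')) (I • (M * Matrix.single l k 1 * M'))) =
      ∑ k, ∑ l, (q (Matrix.single k l 1) (Matrix.single l k 1) - q (I • Matrix.single k l (1 : ℂ)) (I • Matrix.single l k (1 : ℂ))) := by
  -- the balanced part of `q`
  set Qb : Matrix (Fin N) (Fin N) ℂ →ₗ[ℝ] Matrix (Fin N) (Fin N) ℂ →ₗ[ℝ] E :=
    q - q.compl₁₂ (I • LinearMap.id) (I • LinearMap.id) with hQb_def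
  have hQb : ∀ A B, Qb A B = q A B - q (I • A) (I • B) := fun A B => by
    simp only [hQb_def, LinearMap.sub_apply, LinearMap.compl₁₂_apply, LinearMap.smul_apply, LinearMap.id_apply]
  have hbal : ∀ A B, Qb (I • A) B = Qb A (I • B) := fun A B => by
    rw [hQb, hQb, smul_smul, smul_smul, Complex.I_mul_I, neg_one_smul, neg_one_smul, map_neg, LinearMap.neg_apply, map_neg]
    abel
  have hone : ∀ a d, ∑ k, M a k * M' k d = if a = d then (1 : ℂ) else 0 := fun a d => by
    rw [← Matrix.mul_apply, hMM', Matrix.one_apply]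
  simp_rw [← hQb]
  -- contract the inner index `l`
  have hinner : ∀ k, ∑ l, Qb (M * Matrix.single k l 1 * M') (M * Matrix.single l k 1 * M') =
      ∑ b, Qb (M * Matrix.single k b 1) (Matrix.single b k 1 * M') := fun k => by
    simp_rw [conj_single_eq_sum_smul_right M M' k, conj_single_eq_sum_smul_left M M' _ k]
    exact sum_apply_sum_smul_of_balanced Qb hbal (fun b => M * Matrix.single k b 1) (fun c => Matrix.single c k 1 * M')
      (fun l b => M' l b) (fun l c => M c l) fun b c => by simp_rw [mul_comm (M' _ b), hone c b, eq_comm]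
  simp_rw [hinner]
  -- contract the outer index `k`
  rw [Finset.sum_comm]
  have houter : ∀ b, ∑ k, Qb (M * Matrix.single k b 1) (Matrix.single b k 1 * M') = ∑ a, Qb (Matrix.single a b 1) (Matrix.single b a 1) := fun b => by
    simp_rw [mul_single_eq_sum_smul _ b M, single_mul_eq_sum_smul b _ M']
    exact sum_apply_sum_smul_of_balanced Qb hbal (fun a => Matrix.single a b 1) (fun d => Matrix.single b d 1)
      (fun k a => M a k) (fun k d => M' k d) fun a d => hone a d
  simp_rw [houter]
  rw [Finset.sum_comm]


/-- Entries of the `H`-adjoint inverse: `M′_lb = e_l⁻¹ · conj(M_bl) · e_b` when `Mᴴ (diag e) M = diag e`, `M M′ = 1`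
(★ `SU2Block.inv_eq_diagonal_inv_mul_conjTranspose_mul_diagonal`). [cite: HornJohnson2013, §2.2] -/
theorem inv_apply_of_conjTranspose_mul_diagonal_mul {e : Fin N → ℂ} (he : ∀ k, e k ≠ 0) {M M' : Matrix (Fin N) (Fin N) ℂ}
    (hMH : Mᴴ * Matrix.diagonal e * M = Matrix.diagonal e) (hMM' : M * M' = 1) (l b : Fin N) :
    M' l b = (e l)⁻¹ * conj (M b l) * e b := by
  rw [SU2Block.inv_eq_diagonal_inv_mul_conjTranspose_mul_diagonal he hMH hMM', Matrix.mul_diagonal, Matrix.diagonal_mul,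
    Matrix.conjTranspose_apply, Complex.star_def]

/-- **WEIGHTED ROW ORTHOGONALITY of an `H`-unitary matrix**: `Σ_k e_k⁻¹ · M_ak · conj(M_ck) = δ_ac · e_a⁻¹`, i.e. `M H⁻¹ Mᴴ = H⁻¹` (from `M (H⁻¹MᴴH) = M M′ = 1`).
[cite: HornJohnson2013, §2.2] -/
theorem sum_inv_mul_mul_conj_eq {e : Fin N → ℂ} (he : ∀ k, e k ≠ 0) {M M' : Matrix (Fin N) (Fin N) ℂ}
    (hMH : Mᴴ * Matrix.diagonal e * M = Matrix.diagonal e) (hMM' : M * M' = 1) (a c : Fin N) :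
    ∑ k, (e k)⁻¹ * M a k * conj (M c k) = if a = c then (e a)⁻¹ else 0 := by
  have hM' := SU2Block.inv_eq_diagonal_inv_mul_conjTranspose_mul_diagonal he hMH hMM'
  -- `M · diag(e⁻¹) · Mᴴ = diag(e⁻¹)`
  have hkey : M * Matrix.diagonal (fun k => (e k)⁻¹) * Mᴴ = Matrix.diagonal fun k => (e k)⁻¹ := by
    have hee : Matrix.diagonal e * Matrix.diagonal (fun k => (e k)⁻¹) = 1 := by
      rw [Matrix.diagonal_mul_diagonal, ← Matrix.diagonal_one]
      congr 1; funext k; exact mul_inv_cancel₀ (he k)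
    calc M * Matrix.diagonal (fun k => (e k)⁻¹) * Mᴴ
        = M * Matrix.diagonal (fun k => (e k)⁻¹) * Mᴴ * (Matrix.diagonal e * Matrix.diagonal fun k => (e k)⁻¹) := by rw [hee, Matrix.mul_one]
      _ = M * (Matrix.diagonal (fun k => (e k)⁻¹) * Mᴴ * Matrix.diagonal e) * Matrix.diagonal (fun k => (e k)⁻¹) := by
          simp only [Matrix.mul_assoc]
      _ = Matrix.diagonal fun k => (e k)⁻¹ := by rw [← hM', hMM', Matrix.one_mul]
  have h := congr_fun (congr_fun hkey a) c
  rw [Matrix.mul_apply, Matrix.diagonal_apply] at h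
  rw [← h]
  refine Finset.sum_congr rfl fun k _ => ?_
  rw [Matrix.mul_diagonal, Matrix.conjTranspose_apply, Complex.star_def]
  ring

/-- … and its conjugate form `Σ_l e_l⁻¹ · conj(M_bl) · M_dl = δ_bd · e_b⁻¹` (`e` real). [cite: HornJohnson2013, §2.2] -/
theorem sum_inv_mul_conj_mul_eq {e : Fin N → ℂ} (he : ∀ k, e k ≠ 0) (hereal : ∀ k, conj (e k) = e k) {M M' : Matrix (Fin N) (Fin N) ℂ}
    (hMH : Mᴴ * Matrix.diagonal e * M = Matrix.diagonal e) (hMM' : M * M' = 1) (b d : Fin N) :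
    ∑ l, (e l)⁻¹ * conj (M b l) * M d l = if b = d then (e b)⁻¹ else 0 := by
  have h := congrArg conj (sum_inv_mul_mul_conj_eq he hMH hMM' b d)
  rw [map_sum] at h
  simp_rw [map_mul, map_inv₀, hereal, Complex.conj_conj] at h
  rw [h, apply_ite conj, map_inv₀, hereal, map_zero]

/-- **THE `H`-HERMITIAN TWIN OF SWAP IS `Ad`-INVARIANT (real-bilinear form)**: for every real bilinear `q` on `M_N(ℂ)`, `H = diag e` real and nowhere zero, and `M` `H`-unitary
(`MᴴHM = H`, two-sided inverse `M′`):
`Σ_{k,l} re(e_l∕e_k) • [q(M E_kl M′, M E_kl M′) + q(I•M E_kl M′, I•M E_kl M′)] = Σ_{k,l} re(e_l∕e_k) • [q(E_kl, E_kl) + q(I•E_kl, I•E_kl)]`.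
The bracket is the `I`-skew-balanced part of `q` (it factors through `M_N(ℂ) ⊗_ℂ conj M_N(ℂ)`), and `Σ_{k,l} (e_l∕e_k) E_kl ⊗ Ē_kl` is `U(H)`-invariant because `M′ = H⁻¹MᴴH`.
[cite: Hall2015, Prop. 3.24] [cite: HornJohnson2013, §2.2] -/
theorem sum_sum_smul_conj_single_same_eq (q : Matrix (Fin N) (Fin N) ℂ →ₗ[ℝ] Matrix (Fin N) (Fin N) ℂ →ₗ[ℝ] E)
    {e : Fin N → ℂ} (he : ∀ k, e k ≠ 0) (hereal : ∀ k, conj (e k) = e k) {M M' : Matrix (Fin N) (Fin N) ℂ}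
    (hMH : Mᴴ * Matrix.diagonal e * M = Matrix.diagonal e) (hMM' : M * M' = 1) :
    ∑ k, ∑ l, (e l / e k).re • (q (M * Matrix.single k l 1 * M') (M * Matrix.single k l 1 * M') +
        q (I • (M * Matrix.single k l 1 * M')) (I • (M * Matrix.single k l 1 * M'))) =
      ∑ k, ∑ l, (e l / e k).re • (q (Matrix.single k l 1) (Matrix.single k l 1) + q (I • Matrix.single k l (1 : ℂ)) (I • Matrix.single k l (1 : ℂ))) := by
  -- the skew-balanced part of `q`
  set R : Matrix (Fin N) (Fin N) ℂ →ₗ[ℝ] Matrix (Fin N) (Fin N) ℂ →ₗ[ℝ] E :=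
    q + q.compl₁₂ (I • LinearMap.id) (I • LinearMap.id) with hR_def
  have hR : ∀ A B, R A B = q A B + q (I • A) (I • B) := fun A B => by
    simp only [hR_def, LinearMap.add_apply, LinearMap.compl₁₂_apply, LinearMap.smul_apply, LinearMap.id_apply]
  have hskew : ∀ A B, R (I • A) B = -R A (I • B) := fun A B => by
    rw [hR, hR, smul_smul, smul_smul, Complex.I_mul_I, neg_one_smul, neg_one_smul, map_neg, LinearMap.neg_apply, map_neg]
    abel
  -- real weights slide into the left slot as complex scalars
  have hwre : ∀ k l, (((e l / e k).re : ℝ) : ℂ) = e l / e k := fun k l =>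
    Complex.conj_eq_iff_re.1 (by rw [map_div₀, hereal, hereal])
  have hw : ∀ (k l : Fin N) (A B : Matrix (Fin N) (Fin N) ℂ), (e l / e k).re • R A B = R ((e l / e k) • A) B := fun k l A B => by
    conv_rhs => rw [← hwre k l, Complex.coe_smul, map_smul, LinearMap.smul_apply]
  have hM' : ∀ l b, M' l b = (e l)⁻¹ * conj (M b l) * e b := inv_apply_of_conjTranspose_mul_diagonal_mul he hMH hMM'
  have hrow := sum_inv_mul_mul_conj_eq he hMH hMM'
  have hrow' := sum_inv_mul_conj_mul_eq he hereal hMH hMM'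
  simp_rw [← hR, hw]
  -- contract the inner index `l` (the `M′` side)
  have hinner : ∀ k, ∑ l, R ((e l / e k) • (M * Matrix.single k l 1 * M')) (M * Matrix.single k l 1 * M') =
      ∑ b, (e b / e k).re • R (M * Matrix.single k b 1) (M * Matrix.single k b 1) := fun k => by
    simp_rw [conj_single_eq_sum_smul_right M M' k, Finset.smul_sum, smul_smul]
    refine sum_apply_sum_smul_of_skew R hskew (fun b => M * Matrix.single k b 1) (fun b => M * Matrix.single k b 1)
      (fun l b => e l / e k * M' l b) (fun l d => M' l d) (fun b => (e b / e k).re) fun b d => ?_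
    have hterm : ∀ l, e l / e k * M' l b * conj (M' l d) = (e k)⁻¹ * e b * e d * ((e l)⁻¹ * conj (M b l) * M d l) := fun l => by
      rw [hM' l b, hM' l d, map_mul, map_mul, map_inv₀, hereal, hereal, Complex.conj_conj]
      field_simp [he l, he k]
    simp_rw [hterm, ← Finset.mul_sum, hrow' b d, hwre]
    split_ifs with hbd
    · subst hbd; field_simp [he b, he k]
    · rw [mul_zero]
  simp_rw [hinner, hw]
  -- contract the outer index `k` (the `M` side)
  rw [Finset.sum_comm]
  have houter : ∀ b, ∑ k, R ((e b / e k) • (M * Matrix.single k b 1)) (M * Matrix.single k b 1) =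
      ∑ a, (e b / e a).re • R (Matrix.single a b 1) (Matrix.single a b 1) := fun b => by
    simp_rw [mul_single_eq_sum_smul _ b M, Finset.smul_sum, smul_smul]
    refine sum_apply_sum_smul_of_skew R hskew (fun a => Matrix.single a b 1) (fun a => Matrix.single a b 1)
      (fun k a => e b / e k * M a k) (fun k c => M c k) (fun a => (e b / e a).re) fun a c => ?_
    have hterm : ∀ k, e b / e k * M a k * conj (M c k) = e b * ((e k)⁻¹ * M a k * conj (M c k)) := fun k => by
      rw [div_eq_mul_inv]; ring
    simp_rw [hterm, ← Finset.mul_sum, hrow a c, hwre]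
    split_ifs with hac
    · subst hac; rw [div_eq_mul_inv]
    · rw [mul_zero]
  simp_rw [houter]
  rw [Finset.sum_comm]
  exact Finset.sum_congr rfl fun k _ => Finset.sum_congr rfl fun l _ => hw k l _ _


end Literature.LinearAlgebra.Matrix

end
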